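import Mathlib.Algebra.MvPolynomial.Equiv
import Mathlib.Algebra.MvPolynomial.CommRing
import Mathlib.RingTheory.Localization.FractionRing
import Mathlib.RingTheory.MvPolynomial.Basic
import Mathlib.LinearAlgebra.Matrix.Rank
import Mathlib.Data.ENat.Lattice
import Mathlib.Analysis.SpecialFunctions.Log.Basic
import Literature.Computability.AlgebraicComplexity.ArithCircuit
import Literature.Computability.AlgebraicComplexity.SyntacticMultilinear
import HarnessLib

/-!
# Barrier catalogue `ValiantsHypothesis`: the partial-derivative-matrix (full-rank /
min-partition-rank) method cannot prove `ω(n³)` lower bounds for syntactically multilinear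
circuits (Raz–Yehudayoff 2008 via Alon–Kumar–Volk 2020)

D-0021 barrier entry for the summit `ValiantsHypothesis` (`VP ≠ VNP`). Super-polynomial lower
bounds for syntactically multilinear circuits computing the permanent are a CONSEQUENCE of
`ValiantsHypothesis` (a syntactically multilinear circuit is a circuit); the known lower bounds for
multilinear formulas and circuits (Raz; Raz–Yehudayoff; Raz–Shpilka–Yehudayoff;
Alon–Kumar–Volk) are obtained by Raz's partial-derivative-matrix method: exhibit a polynomial
whose coefficient matrices `M_{Y,Z}(f)` have full rank `2^{n/2}` for every balanced partition of
the variables and show that the model cannot compute full-rank polynomials cheaply.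
For syntactically multilinear CIRCUITS this method is capped at `O(n³)`: Raz–Yehudayoff's
full-rank polynomial has a syntactically multilinear circuit of size `O(n³)`.

**The printed results** (checked with `lit read`).

* Raz–Yehudayoff, Comput. Complexity 17 (2008), §2: "An arithmetic circuit is called
  syntactically multilinear if for every product gate `v` with sons `v₁, v₂`, `X_{v₁} ∩ X_{v₂} = ∅`"
  (where `X_v` is the set of variables occurring in `Φ_v`; cf. §3: "every product gate ...
  'multiplies' disjoint sets of variables"). §4.1: for `X = {x_1,…,x_{2n}}`,
  `W = {ω_{i,ℓ,j}}_{i,ℓ,j ∈ [2n]}`, "For every interval `[i,j] ⊆ [2n]` of even length, we define a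
  polynomial `f_{i,j} ∈ F[X,W]` inductively as follows: If the length of `[i,j]` is `0`, then
  define `f_{i,j} = 1`. If the length of `[i,j]` is greater than `0`, then define
  `f_{i,j} = (1 + x_i x_j) f_{i+1,j-1} + ∑_ℓ ω_{i,ℓ,j} f_{i,ℓ} f_{ℓ+1,j}`, where the sum is over
  `ℓ ∈ [i+1, j-2]` such that the interval `[i,ℓ]` is of even length ... Finally, we define
  `f = f_{1,2n}`. ... So, by the definition of `f`, there exists a syntactically multilinear
  arithmetic circuit of size `poly(n)` computing `f`. ... it will be useful to think of `f` also as
  a polynomial in `G[X]`, where `G = F(W)` is the field of rational functions over the field `F`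
  and over the set of variables `W`." §4.2.1–4.2.2: a partition is a one-to-one `A : X → Y ∪ Z`,
  `|Y| = |Z| = n`; "`M_g(p,q)` [is] the coefficient of the monomial `p · q` in `g` ... rows ...
  monic multilinear monomials in `Y`, ... columns ... in `Z`. The size of `M_g` is `2^n × 2^n`. We
  say that the polynomial `g` is of full rank, if for every partition `A` of `X` ... the rank of
  `M_{g^A}` is full." Thm. 4.1 ([R04a,R04b]): a multilinear formula computing a full-rank `g` has
  size `n^{Ω(log n)}`. Thm. 4.2: "Let `G = F(W)` ... Let `f ∈ G[X]` be the polynomial defined in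
  Section 4.1. Then `f` is of full rank (over the field `G`)." Thm. 4.4: (1) multilinear formulas
  for `f` over `F` have size `n^{Ω(log n)}`; (2) "There exists a syntactically multilinear
  arithmetic circuit over the field `F` and the two sets of variables `X` and `W` of depth
  `O(log²(n))` and of size `poly(n)` computing `f`."
* Alon–Kumar–Volk, Combinatorica 40 (2020) (arXiv:1708.02037), Thm. 1: an explicit `n`-variate
  multilinear `f_n` needs syntactically multilinear circuits of size `Ω(n²/log² n)`; §4, Thm. 20
  (arXiv numbering): "Let `f(X) ∈ F[X]` be a multilinear polynomial such that for every balanced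
  partition `X = Y ⊔ Z`, `rank_{Y,Z}(f) = 2^{n/2}`. Let `Ψ` be a syntactically multilinear circuit
  computing `f`. Then `|Ψ| = Ω(n²/log² n)`." §4.1 (closing remark): "Raz and Yehudayoff [RY08]
  constructed a full-rank polynomial `g ∈ F[X, Ω']` that has a syntactically multilinear circuit
  of size `O(n³)`. Their construction also uses a set of auxiliary variables `Ω'` of size `O(n³)`.
  ... we believe that since the rank is taken over `F(Ω')`, it is only fair to consider computations
  over `F(Ω')`, where any rational expression in the variables of `Ω'` is merely a field constant.
  Thus, in this setting, an input gate can be labeled by an arbitrarily complex rational function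
  in the variables of `Ω'`, and the complexity is measured as a function of `|X|` alone. In this
  model the lower bound of Theorem 1 is meaningful, and furthermore, this example shows that the
  partial derivative matrix technique cannot prove an `ω(n³)` lower bound."
* Raz, Theory of Computing 2 (2006), Thm. 1.1 (explicit `f` with poly-size syntactically
  multilinear circuits and multilinear formula size `n^{Ω(log n)}`, "over any field"), Def. 3.5 and
  Cor. 3.6–3.8 (lower bounds from high rank, with auxiliary variables and field extensions).

**Rendering.** Circuits are the tree's `Literature.Computability.AlgebraicComplexity.ArithCircuit` (fan-in two imposed by
`IsFanInTwo`, size = number of gates, inputs and constants free); `IsSyntacticallyMultilinear`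
computes the syntactic variable set `X_v` of every gate by the same left fold as the semantics
(junk forward references contribute `∅`, matching their junk value `0`) and asks the operands of
every product gate to have pairwise disjoint variable sets; `smCircuitSize f : ℕ∞` is the least
size of such a circuit computing `f` (`⊤` if none, e.g. for non-multilinear `f`). AKV's model —
computations over the field `K = F(W)` in the variables `X` alone — is rendered literally:
`K = FractionRing (MvPolynomial W F)`, the Raz–Yehudayoff polynomial transported to `K[X]`
(`razYehudayoffPolyK`), full rank over `K` (`IsFullRank`, all bijections
`Fin (2n) ≃ Fin n ⊕ Fin n`, `Matrix.rank` of the `2^n × 2^n` coefficient matrix `pdMatrix`).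
The printed results enter as named facts (`RazYehudayoff2008_thm42`, full rank;
`RazYehudayoff2008_smCircuit`, the `O(n³)` syntactically multilinear circuit over `K`;
`AlonKumarVolk2020_thm20`, the method's reach); the technique class `FullRankMethodProves K n s`
("full rank over `K` forces syntactically multilinear size `> s`") and the no-go
`FullRankMultilinear` (no `ω(n³)`: refuted at `s = C(n³+1)` over `K = F(W)`) are derived.

## References

* [RazYehudayoff2008] R. Raz, A. Yehudayoff, *Balancing syntactically multilinear arithmetic
  circuits*, Comput. Complexity 17 (2008) 515–535, §2, §4.1, §4.2, Thms. 4.1, 4.2, 4.4.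
* [AlonKumarVolk2020] N. Alon, M. Kumar, B. L. Volk, *Unbalancing sets and an almost quadratic
  lower bound for syntactically multilinear arithmetic circuits*, Combinatorica 40 (2020) 149–178
  (arXiv:1708.02037: Thm. 1; §4 Thm. 20; §4.1 Construction 24, Claim 25, Cor. 26 and closing
  remark).
* [Raz2006] R. Raz, *Separation of multilinear circuit and formula size*, Theory of Computing 2
  (2006) 121–135, Thm. 1.1, Def. 3.5, Cor. 3.6–3.8, §5.
-/

noncomputable section

namespace Literature.Barriers.ValiantsHypothesis

open MvPolynomial Literature.Computability.AlgebraicComplexity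
open Literature.Computability.AlgebraicComplexity.ArithCircuit

universe u v

/-! ### Syntactically multilinear circuits (tree circuit model) -/

section Syntactic

variable {k : Type u} {σ : Type v} [DecidableEq σ]

/-- The syntactic variable set of an operand, given the variable sets of the gates computed so
far (`var i ↦ {i}`, constants `↦ ∅`, `gate j ↦` the `j`-th set, junk references `↦ ∅`).
[cite: RazYehudayoff2008, §2 ("`X_v` the set of variables that occur in `Φ_v`")] -/
def operandVarSet (vs : List (Finset σ)) : Operand k σ → Finset σ
  | .var i => {i}
  | .const _ => ∅
  | .gate j => vs.getD j ∅

/-- The syntactic variable set of a gate: the union over its operands. [cite: RazYehudayoff2008, §2] -/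
def gateVarSet (vs : List (Finset σ)) (g : Gate k σ) : Finset σ :=
  (g.args.map (operandVarSet vs)).foldr (· ∪ ·) ∅

/-- The list of syntactic variable sets `X_v` of the gates of a circuit (left fold, as for the
semantics `ArithCircuit.gateValues`). [cite: RazYehudayoff2008, §2] -/
def gateVarSets (gs : List (Gate k σ)) : List (Finset σ) :=
  gs.foldl (fun vs g => vs ++ [gateVarSet vs g]) []

/-- **Syntactically multilinear circuit**: the operands of every product gate have pairwise
disjoint syntactic variable sets ("for every product gate `v` with sons `v₁, v₂`,
`X_{v₁} ∩ X_{v₂} = ∅`"; pairwise for the tree's unbounded fan-in gates).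
[cite: RazYehudayoff2008, §2] -/
def IsSyntacticallyMultilinear (P : ArithCircuit k σ) : Prop :=
  ∀ (i : ℕ) (args : List (Operand k σ)), P.gates[i]? = some (.prod args) →
    (args.map (operandVarSet (gateVarSets (P.gates.take i)))).Pairwise Disjoint

/-- A gate-free circuit (an input or a constant) is syntactically multilinear. [folklore] -/
theorem isSyntacticallyMultilinear_of_gates_eq_nil {P : ArithCircuit k σ} (h : P.gates = []) :
    IsSyntacticallyMultilinear P := by
  intro i args hi
  simp [h] at hi

variable [CommSemiring k]

/-- **Syntactically multilinear circuit size** of `f`: the least number of gates of a fan-in-two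
syntactically multilinear circuit computing `f`, in `ℕ∞` (`⊤` if there is none, e.g. when `f` is
not multilinear). Convention of the tree's `ArithCircuit.size`: inputs (variables and constants)
are free operands, only gates are counted — so a bare variable has size `0` (`smCircuitSize_X`),
not a defect but the count "number of gates". [cite: RazYehudayoff2008, §2] [cite: AlonKumarVolk2020, Thm. 1] -/
def smCircuitSize (f : MvPolynomial σ k) : ℕ∞ :=
  ⨅ (P : ArithCircuit k σ) (_ : P.IsFanInTwo ∧ IsSyntacticallyMultilinear P ∧ P.Computes f),
    (P.size : ℕ∞)

/-- The infimum is attained by every admissible circuit. [folklore] -/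
theorem smCircuitSize_le {f : MvPolynomial σ k} {P : ArithCircuit k σ} (h2 : P.IsFanInTwo)
    (hsm : IsSyntacticallyMultilinear P) (hf : P.Computes f) : smCircuitSize f ≤ P.size :=
  iInf₂_le P ⟨h2, hsm, hf⟩

/-- Variables have syntactically multilinear size `0` (inputs are free in the tree model). [folklore] -/
theorem smCircuitSize_X (i : σ) : smCircuitSize (X i : MvPolynomial σ k) = 0 :=
  nonpos_iff_eq_zero.mp (by
    simpa [ArithCircuit.size, ArithCircuit.ofVar] using
      smCircuitSize_le (f := (X i : MvPolynomial σ k)) (P := ofVar i)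
        (fun g hg => by simp [ArithCircuit.ofVar] at hg)
        (isSyntacticallyMultilinear_of_gates_eq_nil rfl) rfl)

end Syntactic

/-! ### Bridges to the fact-free copies

The eight declarations of the section above also live, verbatim, in the fact-free file
`Literature/Computability/AlgebraicComplexity/SyntacticMultilinear.lean` (namespace
`Literature.Computability.AlgebraicComplexity`, refactor item `wi-19992`), so that routes can use
the syntactically multilinear model without importing the named facts below. The copies here are
kept because importers and ledger items still reference these names (gate lint
`removes-referenced-decl`); the following identifications (all by unfolding) let users move
statements between the two namespaces until the importers are migrated. -/

section Bridge

variable {k : Type u} {σ : Type v} [DecidableEq σ]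

omit [DecidableEq σ] in
/-- The two `operandVarSet`s agree. [folklore] -/
theorem operandVarSet_eq_algebraicComplexity (vs : List (Finset σ)) (u : Operand k σ) :
    operandVarSet vs u = Literature.Computability.AlgebraicComplexity.operandVarSet vs u := by
  cases u <;> rfl

omit [DecidableEq σ] in
/-- The two `operandVarSet`s agree as functions. [folklore] -/
theorem operandVarSet_eq_algebraicComplexity_fun (vs : List (Finset σ)) :
    (operandVarSet vs : Operand k σ → Finset σ) =
      Literature.Computability.AlgebraicComplexity.operandVarSet vs :=
  funext (operandVarSet_eq_algebraicComplexity vs)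

/-- The two `gateVarSet`s agree. [folklore] -/
theorem gateVarSet_eq_algebraicComplexity (vs : List (Finset σ)) (g : Gate k σ) :
    gateVarSet vs g = Literature.Computability.AlgebraicComplexity.gateVarSet vs g := by
  unfold gateVarSet Literature.Computability.AlgebraicComplexity.gateVarSet
  rw [operandVarSet_eq_algebraicComplexity_fun]

/-- The two `gateVarSets` agree. [folklore] -/
theorem gateVarSets_eq_algebraicComplexity (gs : List (Gate k σ)) :
    gateVarSets gs = Literature.Computability.AlgebraicComplexity.gateVarSets gs := by
  unfold gateVarSets Literature.Computability.AlgebraicComplexity.gateVarSets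
  have h : (gateVarSet : List (Finset σ) → Gate k σ → Finset σ) =
      Literature.Computability.AlgebraicComplexity.gateVarSet :=
    funext fun vs => funext fun g => gateVarSet_eq_algebraicComplexity vs g
  rw [h]

/-- The two syntactic-multilinearity predicates agree. [folklore] -/
theorem isSyntacticallyMultilinear_iff_algebraicComplexity (P : ArithCircuit k σ) :
    IsSyntacticallyMultilinear P ↔
      Literature.Computability.AlgebraicComplexity.IsSyntacticallyMultilinear P := by
  unfold IsSyntacticallyMultilinear
    Literature.Computability.AlgebraicComplexity.IsSyntacticallyMultilinear
  simp only [operandVarSet_eq_algebraicComplexity_fun, gateVarSets_eq_algebraicComplexity]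

/-- The two syntactically multilinear size measures agree. [folklore] -/
theorem smCircuitSize_eq_algebraicComplexity [CommSemiring k] (f : MvPolynomial σ k) :
    smCircuitSize f = Literature.Computability.AlgebraicComplexity.smCircuitSize f := by
  unfold smCircuitSize Literature.Computability.AlgebraicComplexity.smCircuitSize
  simp only [isSyntacticallyMultilinear_iff_algebraicComplexity]

end Bridge

/-! ### The partial-derivative (coefficient) matrix and full rank -/

section FullRank

variable (K : Type u) [Field K]

/-- The exponent vector of the multilinear monomial `∏_{i ∈ S} y_i ∏_{j ∈ T} z_j`. [cite: RazYehudayoff2008, §4.2.2] -/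
def setMonomial {m : ℕ} (S T : Finset (Fin m)) : (Fin m ⊕ Fin m) →₀ ℕ :=
  ∑ i ∈ S, Finsupp.single (Sum.inl i) 1 + ∑ j ∈ T, Finsupp.single (Sum.inr j) 1

variable {K} in
/-- **The partial derivative matrix `M_g`** of `g ∈ K[Y, Z]`, `|Y| = |Z| = m`: rows indexed by
multilinear monomials `p` in `Y` (subsets of `Y`), columns by multilinear monomials `q` in `Z`,
entry the coefficient of `p · q` in `g` (a `2^m × 2^m` matrix). [cite: RazYehudayoff2008, §4.2.2] -/
def pdMatrix {m : ℕ} (g : MvPolynomial (Fin m ⊕ Fin m) K) :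
    Matrix (Finset (Fin m)) (Finset (Fin m)) K :=
  Matrix.of fun S T => coeff (setMonomial S T) g

variable {K} in
/-- **Full rank.** `g ∈ K[x_1,…,x_{2m}]` is of full rank if for every partition `A` of the
variables into `Y` and `Z` with `|Y| = |Z| = m` (a bijection `Fin (2m) ≃ Fin m ⊕ Fin m`) the
partial derivative matrix of `g^A` has full rank `2^m` over `K`. [cite: RazYehudayoff2008, §4.2.2 ("full rank")] [cite: AlonKumarVolk2020, §4 (Thm. 20, hypothesis)] -/
def IsFullRank (m : ℕ) (g : MvPolynomial (Fin (2 * m)) K) : Prop :=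
  ∀ A : Fin (2 * m) ≃ Fin m ⊕ Fin m, (pdMatrix (rename A g)).rank = 2 ^ m

end FullRank

/-! ### The Raz–Yehudayoff full-rank polynomial -/

section RY

variable (F : Type u) [Field F] (N : ℕ)

/-- The variables `X ⊔ W`, `X = {x_0,…,x_{N-1}}`, `W = {ω_{i,ℓ,j}}_{i,ℓ,j < N}` (`N = 2n`). [cite: RazYehudayoff2008, §4.1] -/
abbrev RYVars : Type := Fin N ⊕ (Fin N × Fin N × Fin N)

/-- The auxiliary variables `W`. [cite: RazYehudayoff2008, §4.1] -/
abbrev RYAux : Type := Fin N × Fin N × Fin N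

/-- `x_i` (zero outside the index range; indices are `0`-based). [cite: RazYehudayoff2008, §4.1] -/
def ryX (i : ℕ) : MvPolynomial (RYVars N) F :=
  if h : i < N then X (Sum.inl ⟨i, h⟩) else 0

/-- `ω_{i,ℓ,j}` (zero outside the index range). [cite: RazYehudayoff2008, §4.1] -/
def ryW (i l j : ℕ) : MvPolynomial (RYVars N) F :=
  if h : i < N ∧ l < N ∧ j < N then X (Sum.inr (⟨i, h.1⟩, ⟨l, h.2.1⟩, ⟨j, h.2.2⟩)) else 0

/-- `f_{[i, i+len-1]}` for the interval of length `len` starting at `i` (used for even `len`),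
by the printed recursion `f_{i,j} = (1 + x_i x_j) f_{i+1,j-1} + ∑_ℓ ω_{i,ℓ,j} f_{i,ℓ} f_{ℓ+1,j}`
over `ℓ ∈ [i+1, j-2]` with `[i,ℓ]` of even length `a = ℓ - i + 1 ∈ {2, 4, …, len-2}`, and
`f_{i,j} = 1` for length `0`; the first argument is recursion fuel (any value `≥ len/2 + 1`
computes the printed polynomial; the value at fuel `0` is the junk `1`). [cite: RazYehudayoff2008, §4.1] -/
def ryF : ℕ → ℕ → ℕ → MvPolynomial (RYVars N) F
  | 0, _, _ => 1
  | fuel + 1, len, i =>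
    if len = 0 then 1 else
      (1 + ryX F N i * ryX F N (i + len - 1)) * ryF fuel (len - 2) (i + 1) +
        ∑ a ∈ (Finset.range (len - 1)).filter (fun a => Even a ∧ 2 ≤ a),
          ryW F N i (i + a - 1) (i + len - 1) * ryF fuel a i * ryF fuel (len - a) (i + a)

/-- Length `0` gives `1` (any positive fuel). [cite: RazYehudayoff2008, §4.1] -/
@[simp]
theorem ryF_len_zero (fuel i : ℕ) : ryF F N (fuel + 1) 0 i = 1 := by
  simp [ryF]

/-- Length `2`: `f_{i,i+1} = 1 + x_i x_{i+1}` (the sum is empty). [cite: RazYehudayoff2008, §4.1] -/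
theorem ryF_len_two (fuel i : ℕ) :
    ryF F N (fuel + 2) 2 i = 1 + ryX F N i * ryX F N (i + 1) := by
  rw [ryF]
  simp only [OfNat.ofNat_ne_zero, if_false]
  have hfilter : (Finset.range (2 - 1)).filter (fun a => Even a ∧ 2 ≤ a) = ∅ := by decide
  rw [hfilter, Finset.sum_empty, add_zero, show 2 - 2 = 0 from rfl, ryF_len_zero, mul_one,
    show i + 2 - 1 = i + 1 from rfl]

/-- **The Raz–Yehudayoff polynomial** `f = f_{1,2n} ∈ F[X, W]` (`N = 2n` variables `X`,
`N³` auxiliary variables `W`). [cite: RazYehudayoff2008, §4.1] -/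
def razYehudayoffPoly (n : ℕ) : MvPolynomial (RYVars (2 * n)) F :=
  ryF F (2 * n) (n + 1) (2 * n) 0

/-- The field `K = F(W)` of rational functions in the auxiliary variables.
[cite: RazYehudayoff2008, §4.1 ("`G = F(W)`")] [cite: AlonKumarVolk2020, §4.1 (computations over `F(Ω')`)] -/
abbrev RYField (n : ℕ) : Type u := FractionRing (MvPolynomial (RYAux (2 * n)) F)

/-- `F[X ⊔ W] → K[X]`, `K = F(W)`: separate the variables (`MvPolynomial.sumAlgEquiv`) and embed
the coefficients `F[W] ⊆ F(W)`. [cite: RazYehudayoff2008, §4.1 ("think of `f` also as a polynomial in `G[X]`")] -/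
def toRYField (n : ℕ) : MvPolynomial (RYVars (2 * n)) F →+* MvPolynomial (Fin (2 * n)) (RYField F n) :=
  (MvPolynomial.map (algebraMap (MvPolynomial (RYAux (2 * n)) F) (RYField F n))).comp
    (MvPolynomial.sumAlgEquiv F (Fin (2 * n)) (RYAux (2 * n))).toRingHom

/-- The Raz–Yehudayoff polynomial as an element of `K[X]`, `K = F(W)` (AKV's model: "any
rational expression in the variables of `Ω'` is merely a field constant").
[cite: RazYehudayoff2008, Thm. 4.2] [cite: AlonKumarVolk2020, §4.1] -/
def razYehudayoffPolyK (n : ℕ) : MvPolynomial (Fin (2 * n)) (RYField F n) :=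
  toRYField F n (razYehudayoffPoly F n)

end RY

/-! ### The printed results as named facts (D-0014) -/

/-- **Raz–Yehudayoff 2008, Thm. 4.2.** "Let `G = F(W)` be the field of rational functions over
the field `F` and over the set of variables `W`. Let `f ∈ G[X]` be the polynomial defined in
Section 4.1. Then `f` is of full rank (over the field `G`)." (Any field `F`, every `n`.)
[cite: RazYehudayoff2008, Thm. 4.2] -/
def RazYehudayoff2008_thm42 : Prop :=
  ∀ (F : Type u) [Field F] (n : ℕ), IsFullRank n (razYehudayoffPolyK F n)

/-- **The `O(n³)` syntactically multilinear circuit** (Raz–Yehudayoff 2008, §4.1 / Thm. 4.4(2),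
as counted by Alon–Kumar–Volk 2020, §4.1): "by the definition of `f`, there exists a
syntactically multilinear arithmetic circuit of size `poly(n)` computing `f`"; "[RY08]
constructed a full-rank polynomial `g ∈ F[X, Ω']` that has a syntactically multilinear circuit
of size `O(n³)`"; in AKV's model over `K = F(Ω')` the `Ω'`-inputs are constants, so the same
circuit is a syntactically multilinear circuit over `K` in the variables `X` alone. Rendered with
the tree's gate count: `smCircuitSize ≤ C (n³ + 1)` for a universal `C`.
[cite: AlonKumarVolk2020, §4.1 (closing remark)] [cite: RazYehudayoff2008, §4.1 and Thm. 4.4(2)] -/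
def RazYehudayoff2008_smCircuit : Prop :=
  ∃ C : ℕ, ∀ (F : Type u) [Field F] (n : ℕ),
    smCircuitSize (razYehudayoffPolyK F n) ≤ ((C * (n ^ 3 + 1) : ℕ) : ℕ∞)

/-- **Alon–Kumar–Volk 2020, Thm. 20 (arXiv numbering; the reach of the method).** "Let `n` be an
even integer ... Let `f(X) ∈ F[X]` be a multilinear polynomial such that for every balanced
partition `X = Y ⊔ Z`, `rank_{Y,Z}(f) = 2^{n/2}`. Let `Ψ` be a syntactically multilinear circuit
computing `f`. Then `|Ψ| = Ω(n²/log² n)`." Rendered: a constant `c > 0` with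
`|Ψ| ≥ c n²/log² n` for `n ≥ 2` (here `2n` variables, `n ≥ 2`), every field.
[cite: AlonKumarVolk2020, §4 (Thm. 20) and Thm. 1] -/
def AlonKumarVolk2020_thm20 : Prop :=
  ∃ c : ℝ, 0 < c ∧ ∀ (K : Type u) [Field K] (n : ℕ), 2 ≤ n →
    ∀ (g : MvPolynomial (Fin (2 * n)) K), IsFullRank n g →
      ∀ (P : ArithCircuit K (Fin (2 * n))), P.IsFanInTwo → IsSyntacticallyMultilinear P →
        P.Computes g → c * (n : ℝ) ^ 2 / Real.log n ^ 2 ≤ P.size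

/-! ### Technique class and the barrier -/

/-- **Technique class: the partial-derivative-matrix (full-rank) method at level `s`.** Over the
field `K`, full rank with respect to every balanced partition of the `2n` variables FORCES
syntactically multilinear circuit size `> s` — the inference behind the multilinear lower bounds
of Raz, Raz–Shpilka–Yehudayoff and Alon–Kumar–Volk (complexity "measured as a function of
`|X|` alone", constants of `K` free). [cite: AlonKumarVolk2020, §4 (Thm. 20) and §4.1] [cite: RazYehudayoff2008, Thm. 4.1 and §4.2.2] -/
def FullRankMethodProves (K : Type u) [Field K] (n s : ℕ) : Prop :=
  ∀ g : MvPolynomial (Fin (2 * n)) K, IsFullRank n g → (s : ℕ∞) < smCircuitSize g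

/-- The class is monotone in the certified bound. [folklore] -/
theorem FullRankMethodProves.mono {K : Type u} [Field K] {n s s' : ℕ} (h : s' ≤ s)
    (hs : FullRankMethodProves K n s) : FullRankMethodProves K n s' :=
  fun g hg => lt_of_le_of_lt (by exact_mod_cast h) (hs g hg)

/-- **Barrier: full rank cannot force `ω(n³)` syntactically multilinear size** (Raz–Yehudayoff
2008 + Alon–Kumar–Volk 2020).

BARRIER
technique_class: partial-derivative-matrix, min-partition-rank, full-rank-polynomials, coefficient-matrix-rank, Raz-method, syntactically-multilinear-circuits (`FullRankMethodProves K n s`)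
blocks: super-cubic — in particular super-polynomial — lower bounds for syntactically multilinear CIRCUITS from full-rankness alone, i.e. this way to the multilinear shadow of `ValiantsHypothesis` (no polynomial-size syntactically multilinear circuits for `per_n`, a consequence of `per ∉ VP`): over `K = F(W)` the method certifies nothing beyond `C(n³+1)` (`FullRankMultilinear.not_fullRankMethodProves`, from the named facts) — "this example shows that the partial derivative matrix technique cannot prove an `ω(n³)` lower bound" [cite: AlonKumarVolk2020, §4.1]; its reach is `Ω(n²/log² n)` (`AlonKumarVolk2020_thm20`) [cite: AlonKumarVolk2020, Thm. 1 and §4 (Thm. 20)].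
because: the Raz–Yehudayoff polynomial `f = f_{1,2n}`, `f_{i,j} = (1 + x_i x_j) f_{i+1,j-1} + ∑_ℓ ω_{i,ℓ,j} f_{i,ℓ} f_{ℓ+1,j}` (`razYehudayoffPoly`), is of full rank over `G = F(W)` for EVERY balanced partition (balanced intervals recursively give rank `2^{m}` blocks; `RazYehudayoff2008_thm42`) [cite: RazYehudayoff2008, §4.1, Thm. 4.2 and Lemma 4.3], while its defining recursion is itself a syntactically multilinear circuit with `O(n²)` intervals and `O(n)` summands each, of size `O(n³)` (`poly(n)` as printed by RY), over `F` in `X ⊔ W` and hence over `K = F(W)` in `X` alone (`RazYehudayoff2008_smCircuit`) [cite: RazYehudayoff2008, §4.1 and Thm. 4.4(2)] [cite: AlonKumarVolk2020, §4.1].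
evasions_known: none published for circuits beyond `Ω(n²/log² n)` [cite: AlonKumarVolk2020, Thm. 1]; for weaker models full rank DOES give super-polynomial bounds — multilinear FORMULAS computing a full-rank polynomial have size `n^{Ω(log n)}` (Raz), whence `mVF ≠ mVP` [cite: RazYehudayoff2008, Thm. 4.1 and Thm. 4.4] [cite: Raz2006, Thm. 1.1 and Cor. 3.6–3.8].
scope_caveats: the printed no-go is for syntactically multilinear CIRCUITS in AKV's model (computations over `K = F(Ω')`, complexity as a function of `|X|` alone); nothing is printed here about multilinear ABPs or bounded-depth multilinear circuits; RY print "size `poly(n)`", the count `O(n³)` is AKV's [cite: AlonKumarVolk2020, §4.1]; the tree counts gates of fan-in-two circuits with free inputs/constants (`Literature.Computability.AlgebraicComplexity.ArithCircuit.size`), RY count nodes/edges — immaterial up to the constant `C`; the Lean full-rank notion quantifies over all bijections `Fin (2n) ≃ Fin n ⊕ Fin n` (= all balanced partitions, relabelling within `Y`, `Z` does not change the rank) and the tree's `IsSyntacticallyMultilinear` is the pairwise-disjointness version for unbounded fan-in product gates (equal to print under `IsFanInTwo`); `razYehudayoffPoly` uses `0`-based indices and recursion fuel `n+1` (see `ryF`);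 both named facts are unproved here.
status: theorem (established) [cite: RazYehudayoff2008, Thm. 4.2 and Thm. 4.4] [cite: AlonKumarVolk2020, §4.1] -/
def FullRankMultilinear : Prop :=
  RazYehudayoff2008_thm42.{u} ∧ RazYehudayoff2008_smCircuit.{u}

/-- Unfolding of the barrier fact. [folklore] -/
theorem fullRankMultilinear_iff :
    FullRankMultilinear.{u} ↔ RazYehudayoff2008_thm42.{u} ∧ RazYehudayoff2008_smCircuit.{u} :=
  Iff.rfl

/-- **No `ω(n³)` from full rank**: there is a constant `C` such that over the fields
`K = F(W)` (any field `F`, any `n`) the full-rank method does not certify syntactically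
multilinear size `> C(n³+1)` — the Raz–Yehudayoff polynomial is a full-rank polynomial of
syntactically multilinear size `≤ C(n³+1)`. [cite: AlonKumarVolk2020, §4.1] [cite: RazYehudayoff2008, Thm. 4.2 and §4.1] -/
theorem FullRankMultilinear.not_fullRankMethodProves (h : FullRankMultilinear.{u}) :
    ∃ C : ℕ, ∀ (F : Type u) [Field F] (n : ℕ),
      ¬ FullRankMethodProves (RYField F n) n (C * (n ^ 3 + 1)) := by
  obtain ⟨hfr, C, hC⟩ := h
  refine ⟨C, fun F _ n hm => ?_⟩
  have hlt := hm (razYehudayoffPolyK F n) (hfr F n)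
  exact absurd (hC F n) (not_le.mpr hlt)

/-- Pointed form: over `K = F(W)`, whatever the full-rank method certifies for ALL full-rank
polynomials in `2n` variables is at most `C(n³+1)`. [cite: AlonKumarVolk2020, §4.1] -/
theorem FullRankMultilinear.le_of_fullRankMethodProves (h : FullRankMultilinear.{u}) :
    ∃ C : ℕ, ∀ (F : Type u) [Field F] (n s : ℕ),
      FullRankMethodProves (RYField F n) n s → s ≤ C * (n ^ 3 + 1) := by
  obtain ⟨C, hC⟩ := h.not_fullRankMethodProves
  refine ⟨C, fun F _ n s hs => ?_⟩
  by_contra hlt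
  exact hC F n (hs.mono (not_le.mp hlt).le)

end Literature.Barriers.ValiantsHypothesis
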